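import Mathlib

/-!
# Auxiliary verifications for T1 (Lemma 4.3 parabolic elements; discriminant of the Frey-type family of Lemma 6.1)

Blind cell `pub-manin-gamma0`, seat p3; paper reference `proofs/T1_lead.md` Lemma 4.3 and Lemma 6.1.
* `parabolic_gamma` : for integers `y, h` with `N ∣ y² h`, the matrix `γ = (1 - y h, h; -y² h, 1 + y h)` has determinant `1`, trace `2`,
  lower-left entry divisible by `N` (so `γ ∈ Γ₀(N)`), lower-right entry `1 + y h`, and fixes the vector `(1, y)` (i.e. the cusp `1/y`).
* `discr_legendre_family` : for `E_{A,C} : y² = x (x - A) (x - C)` (Weierstrass coefficients `a₁ = a₃ = a₆ = 0`, `a₂ = -(A + C)`,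
  `a₄ = A C`), Mathlib's discriminant is `Δ = 16 A² C² (A - C)²` and `c₄ = 16 (A² - A C + C²)`, `b₂ = -4(A+C)`, `b₈ = -A²C²`.
Only Mathlib is imported.
-/

namespace ManinGamma
namespace T1Aux

open Matrix
open scoped MatrixGroups

/-- **Lemma 4.3 (parabolic element at the cusp `1/y`).** -/
theorem parabolic_gamma (N y h : ℤ) (hN : N ∣ y ^ 2 * h) :
    Matrix.det !![1 - y * h, h; -(y ^ 2 * h), 1 + y * h] = 1 ∧
    Matrix.trace !![1 - y * h, h; -(y ^ 2 * h), 1 + y * h] = 2 ∧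
    N ∣ (!![1 - y * h, h; -(y ^ 2 * h), 1 + y * h] 1 0) ∧
    (!![1 - y * h, h; -(y ^ 2 * h), 1 + y * h] 1 1) = 1 + y * h ∧
    Matrix.mulVec !![1 - y * h, h; -(y ^ 2 * h), 1 + y * h] ![1, y] = ![1, y] := by
  refine ⟨?_, ?_, ?_, ?_, ?_⟩
  · rw [Matrix.det_fin_two_of]; ring
  · rw [Matrix.trace_fin_two_of]; ring
  · simpa using hN.neg_right
  · simp
  · ext i
    fin_cases i <;> simp [Matrix.mulVec, dotProduct] <;> ring

/-- An element of `SL(2, ℤ)` built from `parabolic_gamma` lies in `Γ₀(N)` (Mathlib's `CongruenceSubgroup.Gamma0`). -/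
theorem parabolic_gamma_mem_Gamma0 (N : ℕ) (y h : ℤ) (hN : (N : ℤ) ∣ y ^ 2 * h) (γ : SL(2, ℤ))
    (hγ : (γ : Matrix (Fin 2) (Fin 2) ℤ) = !![1 - y * h, h; -(y ^ 2 * h), 1 + y * h]) :
    γ ∈ CongruenceSubgroup.Gamma0 N := by
  rw [CongruenceSubgroup.Gamma0_mem, hγ]
  simp only [Matrix.of_apply, Matrix.cons_val', Matrix.cons_val_zero, Matrix.cons_val_one]
  have : ((-(y ^ 2 * h) : ℤ) : ZMod N) = 0 := by
    rw [ZMod.intCast_zmod_eq_zero_iff_dvd]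
    exact hN.neg_right
  simpa using this

/-- **Lemma 6.1, discriminant data of `y² = x(x - A)(x - C)`.** -/
theorem discr_legendre_family {R : Type*} [CommRing R] (W : WeierstrassCurve R) (A C : R)
    (ha₁ : W.a₁ = 0) (ha₂ : W.a₂ = -(A + C)) (ha₃ : W.a₃ = 0) (ha₄ : W.a₄ = A * C) (ha₆ : W.a₆ = 0) :
    W.b₂ = -4 * (A + C) ∧ W.b₄ = 2 * A * C ∧ W.b₆ = 0 ∧ W.b₈ = -(A ^ 2 * C ^ 2) ∧
    W.c₄ = 16 * (A ^ 2 - A * C + C ^ 2) ∧ W.Δ = 16 * A ^ 2 * C ^ 2 * (A - C) ^ 2 := by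
  have hb₂ : W.b₂ = -4 * (A + C) := by rw [WeierstrassCurve.b₂, ha₁, ha₂]; ring
  have hb₄ : W.b₄ = 2 * A * C := by rw [WeierstrassCurve.b₄, ha₁, ha₃, ha₄]; ring
  have hb₆ : W.b₆ = 0 := by rw [WeierstrassCurve.b₆, ha₃, ha₆]; ring
  have hb₈ : W.b₈ = -(A ^ 2 * C ^ 2) := by rw [WeierstrassCurve.b₈, ha₁, ha₂, ha₃, ha₄, ha₆]; ring
  refine ⟨hb₂, hb₄, hb₆, hb₈, ?_, ?_⟩
  · rw [WeierstrassCurve.c₄, hb₂, hb₄]; ring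
  · rw [WeierstrassCurve.Δ, hb₂, hb₄, hb₆, hb₈]; ring

end T1Aux
end ManinGamma
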